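import Mathlib
import Summits.CriticalPhenomena.SAWScalingLimit.Theses.SAWTotalPositivity
import Literature.Probability.RandomPlanarGeometry.SupercriticalSAWPolygons
import Literature.Probability.RandomPlanarGeometry.SAWBridges
import Literature.Probability.LatticeModels.ThermodynamicLimit

/-!
# Sketch — crux stmt-CriticalPhenomena-7117 (`CriticalBubbleBound`), crux-ideate round 1, ideator 1

First-lemma signatures for the two idea cards
`Ideas/scale-indexed-polygon-gas.md` and `Ideas/polygon-chain-renewal.md`.
Everything is phrased over finite sets of edges of `zdGraph 2` (`IsPolygon`, `edgesIn`, `box`)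
and real finite sums, so no convergence bookkeeping is needed; the crux itself is quoted by name.
Nothing here is proved (`def … : Prop` only); the cards say which items are provable now.
-/

noncomputable section

open Finset
open Literature.Probability.LatticeModels
open Literature.Probability.RandomPlanarGeometry

namespace Summit.CriticalPhenomena.SAWScalingLimit.Cruxes.CriticalBubbleBound.Sketch

/-! ### Critical polygons in a box -/

open Classical in
/-- Self-avoiding polygons of `ℤ²` (edge sets of cycles) all of whose edges lie in `{-N,…,N}²`. -/
def polygonsIn (N : ℕ) : Finset (Finset (Sym2 (Site 2))) :=
  (edgesIn (zdGraph 2) (box 2 N)).powerset.filter fun E => SAW.IsPolygon (zdGraph 2) E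

/-- The critical weight `x_c^{|P|}` of a polygon (`|P|` = number of edges = number of vertices). -/
def wt (E : Finset (Sym2 (Site 2))) : ℝ := SAW.criticalFugacity ^ E.card

/-- `v` is a vertex of the edge set `E`. -/
def IsVertex (v : Site 2) (E : Finset (Sym2 (Site 2))) : Prop := ∃ e ∈ E, v ∈ e

/-- `E` fits in a translate of the box `{-R,…,R}²` (ℓ∞-diameter `≤ 2R`). -/
def FitsIn (R : ℕ) (E : Finset (Sym2 (Site 2))) : Prop :=
  ∃ v : Site 2, ∀ e ∈ E, ∀ x ∈ e, x - v ∈ box 2 R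

/-- Dyadic scale class: diameter in `(2R, 4R]`. -/
def AtScale (R : ℕ) (E : Finset (Sym2 (Site 2))) : Prop := FitsIn (2 * R) E ∧ ¬ FitsIn R E

/-- Representative of a translation class: `0` is a vertex and every vertex is lexicographically
`≥ 0` (first coordinate `> 0`, or `= 0` with second coordinate `≥ 0`). -/
def IsLexRooted (E : Finset (Sym2 (Site 2))) : Prop :=
  IsVertex 0 E ∧ ∀ e ∈ E, ∀ x ∈ e, 0 < x 0 ∨ (x 0 = 0 ∧ 0 ≤ x 1)

/-- The polygon has width (extent of the first coordinate) exactly `w`. -/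
def HasWidth (w : ℕ) (E : Finset (Sym2 (Site 2))) : Prop :=
  (∀ e ∈ E, ∀ x ∈ e, ∀ e' ∈ E, ∀ y ∈ e', y 0 - x 0 ≤ w) ∧
    ∃ e ∈ E, ∃ x ∈ e, ∃ e' ∈ E, ∃ y ∈ e', y 0 - x 0 = w

open Classical in
/-- `T_N := Σ_{P ∋ 0, P ⊆ Λ_N} x_c^{|P|}`, the ROOTED critical polygon mass in the box. -/
def rootedMass (N : ℕ) : ℝ :=
  ∑ E ∈ (polygonsIn N).filter (fun E => IsVertex 0 E), wt E

open Classical in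
/-- `t_R(N) :=` rooted mass of the polygons through `0` at dyadic scale `R` (inside `Λ_N`). -/
def rootedScaleMass (R N : ℕ) : ℝ :=
  ∑ E ∈ (polygonsIn N).filter (fun E => IsVertex 0 E ∧ AtScale R E), wt E

open Classical in
/-- `M_R :=` mass of ALL polygons at scale `R` inside `Λ_{6R}` (no root). -/
def scaleMass (R : ℕ) : ℝ :=
  ∑ E ∈ (polygonsIn (6 * R)).filter (fun E => AtScale R E), wt E

open Classical in
/-- `L_R := Σ_{P ⊆ Λ_{6R}, P at scale R} |P|·x_c^{|P|}`, the LENGTH-weighted scale mass. -/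
def lengthScaleMass (R : ℕ) : ℝ :=
  ∑ E ∈ (polygonsIn (6 * R)).filter (fun E => AtScale R E), (E.card : ℝ) * wt E

open Classical in
/-- `D_R(ρ) :=` mass of the `ρ`-DENSE polygons at scale `R` (at least `ρ(2R+1)²` edges). -/
def denseMass (ρ : ℝ) (R : ℕ) : ℝ :=
  ∑ E ∈ (polygonsIn (6 * R)).filter (fun E => AtScale R E ∧ ρ * ((2 * R + 1) ^ 2 : ℝ) ≤ E.card),
    wt E

open Classical in
/-- `m_R(N) :=` mass of translation CLASSES (lex-rooted representatives) at scale `R`. -/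
def classScaleMass (R N : ℕ) : ℝ :=
  ∑ E ∈ (polygonsIn N).filter (fun E => IsLexRooted E ∧ AtScale R E), wt E

open Classical in
/-- `P_N := Σ_{[P] ⊆ Λ_N} x_c^{|P|}` over translation classes (lex-rooted representatives). -/
def classMass (N : ℕ) : ℝ :=
  ∑ E ∈ (polygonsIn N).filter (fun E => IsLexRooted E), wt E

/-- The lattice neighbour `e₁ = (1,0)` of the origin. -/
def e1 : Site 2 := ![1, 0]

open Classical in
/-- `H_N :=` critical mass of polygons through the edge `{0,e₁}` lying in the closed upper
half-plane (= `x_c ·` the half-plane two-point function `Z_ℍ(0,e₁)` truncated to `Λ_N`). -/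
def halfPlaneMass (N : ℕ) : ℝ :=
  ∑ E ∈ (polygonsIn N).filter (fun E => s((0 : Site 2), e1) ∈ E ∧ ∀ e ∈ E, ∀ x ∈ e, 0 ≤ x 1),
    wt E

/-! ### Card `scale-indexed-polygon-gas` -/

/-- (A0-eq) The crux is the boundedness of the rooted critical polygon mass
(`T = 2x_c(G_{z_c}(0,e₁) − x_c)` by the edge/vertex double count and the `D₄`-symmetry of `Λ_N`;
monotone exhaustion of `Ω_δ` by boxes). Provable now. -/
def BubbleIffRootedMass : Prop :=
  Summit.CriticalPhenomena.SAWScalingLimit.Theses.SAWTotalPositivity.CriticalBubbleBound ↔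
    ∃ C : ℝ, ∀ N : ℕ, rootedMass N ≤ C

/-- (A0) TRANSLATION AVERAGING — the lever of card 1: the rooted mass at scale `R` is at most
the length-weighted scale mass divided by the area of the averaging box,
`t_R ≤ L_R / (2R+1)²` (root the polygon at a uniformly chosen site of `{-R,…,R}²`). Provable now. -/
def AveragingIneq : Prop :=
  ∀ R N : ℕ, 1 ≤ R → rootedScaleMass R N ≤ lengthScaleMass R / ((2 * R + 1) ^ 2 : ℝ)

/-- (A1) SCALE-MASS BOUND (hyperscaling upper bound for the critical polygon gas): `O(1)` critical
polygons per dyadic scale per box. Open; implies `p_n ≤ C μⁿ/n` for ALL `n` and `Σ p_n μ^{-n} < ∞`. -/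
def ScaleMassBound : Prop :=
  ∃ C : ℝ, ∀ R : ℕ, 1 ≤ R → scaleMass R ≤ C

/-- (A2) LOG-SPARSITY: the length-weighted critical mass at scale `R` is `o(R²)`, summably over
dyadic scales: `L_R ≤ C (2R+1)² / (log R)^{1+ε}`. Truth (Flory/Nienhuis): `L_R ≍ R^{4/3}`. Open. -/
def LogSparsity : Prop :=
  ∃ C ε : ℝ, 0 < ε ∧ ∀ R : ℕ, 2 ≤ R →
    lengthScaleMass R ≤ C * ((2 * R + 1) ^ 2 : ℝ) / Real.log R ^ (1 + ε)

/-- (A2') DENSE-MASS BOUND: `ρ_R`-dense critical polygons at scale `R`, `ρ_R = (log R)^{-1-ε}`,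
carry mass `≤ C (log R)^{-1-ε}`. With (A1) it gives (A2) (split `L_R` at density `ρ_R`). Open;
any quantitative form of "critical SAPs have zero density" (cousin of DKY Problem 10) implies it. -/
def DenseMassBound : Prop :=
  ∃ C ε : ℝ, 0 < ε ∧ ∀ R : ℕ, 2 ≤ R →
    denseMass ((Real.log R ^ (1 + ε))⁻¹) R ≤ C / Real.log R ^ (1 + ε)

/-- Bookkeeping (provable now): `L_R ≤ ρ(2R+1)²·M_R + 2(12R+1)²·D_R(ρ)`. -/
def DensitySplit : Prop :=
  ∀ (ρ : ℝ) (R : ℕ), 0 ≤ ρ →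
    lengthScaleMass R ≤ ρ * ((2 * R + 1) ^ 2 : ℝ) * scaleMass R
      + 2 * ((12 * R + 1) ^ 2 : ℝ) * denseMass ρ R

/-- The glue of card 1 (provable now, dyadic summation of (A0)): log-sparsity closes the crux. -/
def SparsitySuffices : Prop :=
  AveragingIneq → LogSparsity → ∃ C : ℝ, ∀ N : ℕ, rootedMass N ≤ C

/-- … and (A1) + (A2') give (A2). -/
def ScaleAndDenseSuffice : Prop :=
  DensitySplit → ScaleMassBound → DenseMassBound → LogSparsity

/-! ### Card `polygon-chain-renewal` -/

/-- UNROOTED POLYGON MASS FINITE on `ℤ²`: `Σ_n p_n μ^{-n} < ∞`, i.e. the class mass is bounded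
uniformly in the box ("α_sing < 2"; known on the hexagonal lattice via the Duminil-Copin–Smirnov
arc bound, open on `ℤ²`). The milestone the lever of card 2 reaches. -/
def UnrootedPolygonMassFinite : Prop :=
  ∃ C : ℝ, ∀ N : ℕ, classMass N ≤ C

/-- HALF-PLANE BUBBLE on `ℤ²` (the route's foreseen child `HalfPlaneBubble` of this crux):
`Z_ℍ(0,e₁) < ∞`. -/
def HalfPlaneBubbleZ2 : Prop :=
  ∃ C : ℝ, ∀ N : ℕ, halfPlaneMass N ≤ C

/-- BUMP INJECTION (provable now): pushing one lowest-row edge of a class down by a unit square is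
injective and costs `x_c²`, so `P_N ≤ H_N·x_c^{0} ≤ μ² P_{N+1}`-type bounds hold both ways:
half-plane bubble ⟺ unrooted polygon mass finite. -/
def BumpEquivalence : Prop :=
  HalfPlaneBubbleZ2 ↔ UnrootedPolygonMassFinite

open Classical in
/-- KESTEN WIDTH INJECTION (provable now, given `KestenSpanBound`): cut a class of width `w` at its
lex-smallest and lex-largest vertices and reflect the second arc: an injection into x-bridges of
span `2w+1` costing one extra step, so `Σ_{[P]: width w} x_c^{|P|} ≤ μ · B_{2w+1}(x_c)`
(truncated sums; `4(2N+1)²` bounds the number of edges in `Λ_N`). -/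
def WidthInjection : Prop :=
  ∀ w N : ℕ,
    (∑ E ∈ (polygonsIn N).filter (fun E => IsLexRooted E ∧ HasWidth w E), wt E) ≤
      SAW.criticalFugacity⁻¹ *
        ∑ n ∈ Finset.range (4 * (2 * N + 1) ^ 2 + 2),
          ∑ ω ∈ (SAW.Zd.bridges 2 n).filter (fun ω => ω n 0 = 2 * (w : ℤ) + 1),
            SAW.criticalFugacity ^ n

open Classical in
/-- KESTEN'S SPAN BOUND (Kesten 1963; Madras–Slade §4.2: the critical mass of bridges of a given
span is a renewal probability, hence `≤ 1`). Literature fact, not yet in the tree (the tree has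
`le_connectiveConstant_of_kraft`, i.e. `Σ_{irreducible} μ^{-|β|} ≤ 1`, and unique decoding). -/
def KestenSpanBound : Prop :=
  ∀ T M : ℕ, 1 ≤ T →
    (∑ n ∈ Finset.range M,
        ∑ ω ∈ (SAW.Zd.bridges 2 n).filter (fun ω => ω n 0 = (T : ℤ)),
          SAW.criticalFugacity ^ n) ≤ 1

open Classical in
/-- `A_i(N) := Σ_{[P]: 2^i ≤ |P| < 2^{i+1}} x_c^{|P|}` — critical mass of the dyadic LENGTH block
(translation classes inside `Λ_N`), i.e. `Σ_{n ∈ [2^i,2^{i+1})} p_n μ^{-n}` truncated to the box. -/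
def dyadicMass (i N : ℕ) : ℝ :=
  ∑ E ∈ (polygonsIn N).filter (fun E => IsLexRooted E ∧ 2 ^ i ≤ E.card ∧ E.card < 2 ^ (i + 1)),
    wt E

/-- MASS JOINING INEQUALITY — the lever of card 2 (Hammond 2018 Prop. 4.5 + Lemmas 4.9/4.11 +
Madras join, summed over the block with `μ^{-n}` weights; the global-join-plaquette tail replaces
the high-polygon-number hypothesis): `A_{i-1}² ≤ C·i·2^{-i/2}·(A_i + A_{i+1}) + C·2^{-4i}`,
uniformly in the box (`N' = N + 2^{i+2}` leaves room for the joined polygon). -/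
def MassJoinIneq : Prop :=
  ∃ C : ℝ, ∀ i N : ℕ, 2 ≤ i →
    dyadicMass (i - 1) N ^ 2 ≤
      C * i * (Real.sqrt 2)⁻¹ ^ i * (dyadicMass i (N + 2 ^ (i + 2)) + dyadicMass (i + 1) (N + 2 ^ (i + 2)))
        + C * (2 : ℝ)⁻¹ ^ (4 * i)

/-- DYADIC MASS BOUND (the bootstrap's fixed point; "θ ≥ 3/2 on every dyadic block"):
`Σ_{n∈[2^i,2^{i+1})} p_n μ^{-n} ≤ C (i+1) 2^{-i/2}`. From `MassJoinIneq` and the a-priori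
`A_i ≤ 2^i` (`p_n ≤ μⁿ`) by square-root iteration — provable now GIVEN `MassJoinIneq`. -/
def DyadicMassBound : Prop :=
  ∃ C : ℝ, ∀ i N : ℕ, dyadicMass i N ≤ C * (i + 1) * (Real.sqrt 2)⁻¹ ^ i

/-- The bootstrap (provable now): -/
def BootstrapStep : Prop := MassJoinIneq → DyadicMassBound

/-- … and its summation (provable now): `Σ_i C(i+1)2^{-i/2} < ∞`. -/
def DyadicMassBoundSuffices : Prop := DyadicMassBound → UnrootedPolygonMassFinite

/-- Scale-class variant of the bootstrap target: class mass at scale `R` is `≤ C (log R + 1)/R` (the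
summable fixed point of side-by-side joining with gain `R`; Madras's `n^{-1/2}` is its fixed-length shadow). -/
def ScaleClassBound : Prop :=
  ∃ C : ℝ, ∀ R N : ℕ, 1 ≤ R → classScaleMass R N ≤ C * (Real.log R + 1) / R

/-- Dyadic summation (provable now): `Σ_k C (k+1) 2^{-k} < ∞`. -/
def ScaleClassBoundSuffices : Prop :=
  ScaleClassBound → UnrootedPolygonMassFinite

end Summit.CriticalPhenomena.SAWScalingLimit.Cruxes.CriticalBubbleBound.Sketch
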